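import Literature.ModelTheory.ProofTheory.ExistentialCodes
import Mathlib.ModelTheory.Order

/-!
# Letters of lifted formulas, of the derived connectives, and of order atoms

Support file for recursiveness proofs of axiom *schemes* (first client: the definable
completeness scheme `[DC]`, `Literature/ModelTheory/ExponentialFields/DefinableCompletenessCodes.lean`),
continuing the arithmetization of Mathlib's Gödel numbering of
`Literature/ModelTheory/ProofTheory/GodelCoding.lean` (`termLetters`, `formulaLetters`) and
`SentenceCodes.lean` (Enderton, *A Mathematical Introduction to Logic*, §3.4, arithmetization of
syntax: the syntactic operations are recursive on Gödel numbers).  Schemes quantify auxiliary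
variables around an arbitrary formula `φ`, which in Mathlib's locally nameless syntax means
`BoundedFormula.liftAt`; so the main result here is the letter-level description of lifting:

* `bumpVar`, `liftTermCode`, `liftLetter`, `liftLetters` — the transformation of letters
  (a variable letter `4 i + 2` with `m ≤ i` becomes `4 (i + j) + 2` inside the term codes; depth
  tags `4 k + 3`, falsum letters `4 k + 11` and the depth component of term letters `2 ⟨k, c⟩`
  are raised; a depth tag is told apart from the connective letters `3`, `7` by the preceding
  relation header `4 r + 1`);
* `termLetters_liftAt`, `encode_liftAt`, **`formulaLetters_liftAt`**:
  `formulaLetters (φ.liftAt j m) = liftLetters j m (formulaLetters φ)`;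
* letters of the derived connectives `∼`, `⊓`, of the closure `alls`, and of the order atom
  `&i₁ ≤ &i₂` (`formulaLetters_not/inf/alls/le_var`; `formulaLetters_ex` is in
  `ExistentialCodes.lean`), with the corresponding letter builders `exLetters`, `leLetters`;
* primitive recursiveness of all these letter transformations (`primrec_liftLetters`,
  `primrec_exLetters`, `primrec_leLetters`, …).

Everything is proved; no definitions of mathematical content, no named facts.

## References

* H. B. Enderton, *A Mathematical Introduction to Logic*, 2nd ed. (2001), §3.4.
* Mathlib, `Mathlib/ModelTheory/Syntax.lean` (`Term.liftAt`, `BoundedFormula.liftAt`,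
  `BoundedFormula.alls`), `Mathlib/Computability/Primrec.lean`.
-/

namespace Literature.ModelTheory.ProofTheory.PreFOL

open FirstOrder FirstOrder.Language Encodable Denumerable

/-! ### Lifting bound variables on letters -/

/-- On a term letter: a variable letter `4 i + 2` with `m ≤ i` becomes `4 (i + j) + 2`; all other
letters (variables below `m`, function symbols `2 f + 1`) are unchanged. [folklore] -/
def bumpVar (j m x : ℕ) : ℕ := if x % 4 = 2 ∧ m ≤ x / 4 then x + 4 * j else x

/-- On the code of a term (the code of its letter list): bump every variable letter. [folklore] -/
def liftTermCode (j m c : ℕ) : ℕ := encode ((ofNat (List ℕ) c).map (bumpVar j m))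

/-- On a formula letter, given the previous letter `prev`: a term letter `2 ⟨k, c⟩` becomes
`2 ⟨k + j, liftTermCode c⟩`; a relation header `4 r + 1` is unchanged; a depth tag `4 k + 3`
(the letter after a relation header) and a falsum letter `4 k + 11` are raised by `4 j`; the
connective letters `3`, `7` are unchanged. [folklore] -/
def liftLetter (j m prev x : ℕ) : ℕ :=
  if x % 2 = 0 then 2 * Nat.pair ((Nat.unpair (x / 2)).1 + j) (liftTermCode j m (Nat.unpair (x / 2)).2)
  else if x % 4 = 1 then x
  else if prev % 4 = 1 then x + 4 * j
  else if 11 ≤ x then x + 4 * j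
  else x

/-- Lifting a list of formula letters, remembering the previous letter (initially anything that
is not a relation header, e.g. `0`). [folklore] -/
def liftLettersAux (j m : ℕ) : ℕ → List ℕ → List ℕ
  | _, [] => []
  | prev, x :: l => liftLetter j m prev x :: liftLettersAux j m x l

/-- Lifting a list of formula letters. [folklore] -/
def liftLetters (j m : ℕ) (l : List ℕ) : List ℕ := liftLettersAux j m 0 l

/-- Lifting no letters. [folklore] -/
@[simp] theorem liftLettersAux_nil (j m p : ℕ) : liftLettersAux j m p [] = [] := rfl

/-- Lifting one more letter. [folklore] -/
theorem liftLettersAux_cons (j m p x : ℕ) (l : List ℕ) :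
    liftLettersAux j m p (x :: l) = liftLetter j m p x :: liftLettersAux j m x l := rfl

/-- Lifting a concatenation: the second part is lifted remembering the last letter of the first.
[folklore] -/
theorem liftLettersAux_append (j m : ℕ) : ∀ (p : ℕ) (l₁ l₂ : List ℕ),
    liftLettersAux j m p (l₁ ++ l₂) = liftLettersAux j m p l₁ ++ liftLettersAux j m (l₁.getLastD p) l₂
  | p, [], l₂ => by simp
  | p, x :: l₁, l₂ => by
    rw [List.cons_append, liftLettersAux_cons, liftLettersAux_cons, liftLettersAux_append j m x l₁ l₂,
      List.cons_append, List.getLastD_cons]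

/-- Only whether the previous letter is a relation header matters. [folklore] -/
theorem liftLettersAux_congr (j m : ℕ) {p p' : ℕ} (h : (p % 4 = 1 ↔ p' % 4 = 1)) (l : List ℕ) :
    liftLettersAux j m p l = liftLettersAux j m p' l := by
  cases l with
  | nil => rfl
  | cons x l =>
    rw [liftLettersAux_cons, liftLettersAux_cons]
    congr 1
    unfold liftLetter
    by_cases hp : p % 4 = 1
    · have hp' : p' % 4 = 1 := h.1 hp
      simp [hp, hp']
    · have hp' : ¬ p' % 4 = 1 := fun h' => hp (h.2 h')
      simp [hp, hp']

section Letters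

variable {L : Language} [Encodable (Σ i, L.Functions i)] [Encodable (Σ i, L.Relations i)]

omit [Encodable (Σ i, L.Relations i)] in
/-- Letters of a lifted term: every variable letter is bumped. [folklore] -/
theorem termLetters_liftAt {n : ℕ} (j m : ℕ) (t : L.Term (Empty ⊕ Fin n)) :
    termLetters (t.liftAt j m) = (termLetters t).map (bumpVar j m) := by
  rw [Term.liftAt]
  induction t with
  | var a =>
    rcases a with e | i
    · exact e.elim
    · simp only [Term.relabel, Sum.map_inr, termLetters_var, List.map_cons, List.map_nil, bumpVar]
      have h1 : (4 * i.val + 2) % 4 = 2 := by omega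
      have h2 : (4 * i.val + 2) / 4 = i.val := by omega
      by_cases hm : m ≤ i.val
      · have hlt : ¬ (i.val < m) := by omega
        simp only [hlt, if_false, Fin.val_addNat, h1, h2, hm, and_self, if_true]
        simp only [List.cons.injEq, and_true]
        ring
      · have hlt : i.val < m := by omega
        simp [hlt, h1, h2, hm]
  | func F ts ih =>
    simp only [Term.relabel, termLetters_func, List.map_cons]
    have hodd : bumpVar j m (2 * encode (⟨_, F⟩ : Σ i, L.Functions i) + 1) =
        2 * encode (⟨_, F⟩ : Σ i, L.Functions i) + 1 := by
      unfold bumpVar; rw [if_neg]; omega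
    rw [hodd, List.map_flatten, List.map_ofFn]
    congr 2
    exact congrArg List.ofFn (funext fun i => by simpa using ih i)

omit [Encodable (Σ i, L.Relations i)] in
/-- The code of a lifted term. [folklore] -/
theorem encode_liftAt {n : ℕ} (j m : ℕ) (t : L.Term (Empty ⊕ Fin n)) :
    encode (t.liftAt j m) = liftTermCode j m (encode t) := by
  rw [liftTermCode, ofNat_encode_term, ← termLetters_liftAt, encode_term_eq]

/-- The letters of a formula form a non-empty list. [folklore] -/
theorem formulaLetters_ne_nil {k : ℕ} (φ : L.BoundedFormula Empty k) : formulaLetters φ ≠ [] := by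
  cases φ <;> simp

omit [Encodable (Σ i, L.Functions i)] [Encodable (Σ i, L.Relations i)] in
/-- The last element of `l₁ ++ x :: l₂` does not depend on `l₁`. [folklore] -/
theorem getLastD_append_cons (l₁ : List ℕ) (x : ℕ) (l₂ : List ℕ) (a : ℕ) :
    (l₁ ++ x :: l₂).getLastD a = (x :: l₂).getLastD a := by
  induction l₁ generalizing a with
  | nil => rfl
  | cons y l₁ ih => rw [List.cons_append, List.getLastD_cons, ih, List.getLastD_cons, List.getLastD_cons]

/-- The last letter of a formula is never a relation header `4 r + 1`. [folklore] -/
theorem getLastD_formulaLetters_mod_four {k : ℕ} (φ : L.BoundedFormula Empty k) :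
    ∀ (p : ℕ), p % 4 ≠ 1 → ((formulaLetters φ).getLastD p) % 4 ≠ 1 := by
  induction φ with
  | falsum => intro p _; simp
  | equal t₁ t₂ => intro p _; simp; omega
  | @rel n' a R ts =>
    intro p _
    rw [formulaLetters_rel, List.getLastD_cons, List.getLastD_cons]
    have hmem := List.getLastD_mem_cons (l := List.ofFn fun i => 2 * Nat.pair n' (encode (ts i)))
      (a := 4 * n' + 3)
    rcases List.mem_cons.1 hmem with h | h
    · rw [h]; omega
    · obtain ⟨i, hi⟩ := List.mem_ofFn.1 h
      rw [← hi]; omega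
  | imp φ ψ _ ihψ =>
    intro p hp
    obtain ⟨x, l₂, hx⟩ := List.exists_cons_of_ne_nil (formulaLetters_ne_nil ψ)
    rw [formulaLetters_imp, List.getLastD_cons, hx, getLastD_append_cons, ← hx]
    exact ihψ _ (by omega)
  | all φ ih => intro p _; rw [formulaLetters_all, List.getLastD_cons]; exact ih 7 (by decide)

/-- `castLE` along an equality of depths does not change the letters. [folklore] -/
theorem formulaLetters_castLE_eq {a b : ℕ} (h : a ≤ b) (e : a = b) (φ : L.BoundedFormula Empty a) :
    formulaLetters (φ.castLE h) = formulaLetters φ := by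
  subst e; rw [BoundedFormula.castLE_rfl]

omit [Encodable (Σ i, L.Functions i)] [Encodable (Σ i, L.Relations i)] in
/-- On a list of term letters (all even) lifting acts letter by letter, whatever the previous
letter. [folklore] -/
theorem liftLettersAux_of_forall_even (j m : ℕ) :
    ∀ (p : ℕ) (l : List ℕ), (∀ x ∈ l, x % 2 = 0) →
      liftLettersAux j m p l =
        l.map fun x => 2 * Nat.pair ((Nat.unpair (x / 2)).1 + j) (liftTermCode j m (Nat.unpair (x / 2)).2)
  | p, [], _ => rfl
  | p, x :: l, h => by
    rw [liftLettersAux_cons, List.map_cons, liftLettersAux_of_forall_even j m x l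
      (fun y hy => h y (List.mem_cons_of_mem x hy))]
    congr 1
    unfold liftLetter
    rw [if_pos (h x List.mem_cons_self)]

omit [Encodable (Σ i, L.Functions i)] [Encodable (Σ i, L.Relations i)] in
/-- Lifting a term letter `2 ⟨k, c⟩`. [folklore] -/
theorem liftLetter_termLetter (j m p k c : ℕ) :
    liftLetter j m p (2 * Nat.pair k c) = 2 * Nat.pair (k + j) (liftTermCode j m c) := by
  unfold liftLetter
  rw [if_pos (by omega), Nat.mul_div_cancel_left _ (by norm_num), Nat.unpair_pair]

/-- **Letters of a lifted formula**: `formulaLetters (φ.liftAt j m)` is obtained from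
`formulaLetters φ` letter by letter (`liftLetters`). [folklore] -/
theorem formulaLetters_liftAt {n : ℕ} (j m : ℕ) (φ : L.BoundedFormula Empty n) :
    formulaLetters (φ.liftAt j m) = liftLetters j m (formulaLetters φ) := by
  simp only [BoundedFormula.liftAt]
  induction φ with
  | falsum =>
    simp only [BoundedFormula.mapTermRel, formulaLetters_falsum, liftLetters, liftLettersAux_cons,
      liftLettersAux_nil, List.cons.injEq, and_true]
    unfold liftLetter
    rw [if_neg (by omega), if_neg (by omega), if_neg (by omega), if_pos (by omega)]
    ring
  | equal t₁ t₂ =>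
    simp only [BoundedFormula.mapTermRel, formulaLetters_equal, encode_liftAt, liftLetters,
      liftLettersAux_cons, liftLettersAux_nil, liftLetter_termLetter]
  | @rel k a R ts =>
    simp only [BoundedFormula.mapTermRel, formulaLetters_rel, encode_liftAt, liftLetters,
      liftLettersAux_cons]
    refine congrArg₂ _ ?_ (congrArg₂ _ ?_ ?_)
    · unfold liftLetter; rw [if_neg (by omega), if_pos (by omega)]; rfl
    · unfold liftLetter; rw [if_neg (by omega), if_neg (by omega), if_pos (by omega)]; ring
    · rw [liftLettersAux_of_forall_even j m _ _ (fun x hx => by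
        obtain ⟨i, rfl⟩ := List.mem_ofFn.1 hx; omega), List.map_ofFn]
      exact congrArg List.ofFn (funext fun i => by
        simp [Nat.unpair_pair])
  | imp φ ψ ihφ ihψ =>
    simp only [BoundedFormula.mapTermRel, formulaLetters_imp, liftLetters, liftLettersAux_cons] at *
    refine congrArg₂ _ ?_ ?_
    · unfold liftLetter; rw [if_neg (by omega), if_neg (by omega), if_neg (by omega), if_neg (by omega)]
    · rw [liftLettersAux_append, liftLettersAux_congr j m (p := 3) (p' := 0) (by decide), ihφ,
        liftLettersAux_congr j m (p' := 0) ⟨fun h => absurd h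
          (getLastD_formulaLetters_mod_four φ 3 (by decide)), fun h => absurd h (by decide)⟩, ihψ]
  | all φ ih =>
    simp only [BoundedFormula.mapTermRel, formulaLetters_all, liftLetters, liftLettersAux_cons] at *
    refine congrArg₂ _ ?_ ?_
    · unfold liftLetter; rw [if_neg (by omega), if_neg (by omega), if_neg (by omega), if_neg (by omega)]
    · rw [formulaLetters_castLE_eq _ (by omega), ih, liftLettersAux_congr j m (p := 7) (p' := 0) (by decide)]

end Letters

section DerivedLetters

variable {L : Language} [Encodable (Σ i, L.Functions i)] [Encodable (Σ i, L.Relations i)]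

/-- Letters of `⊥` at depth `k` (the `Bot` instance is `falsum`). [folklore] -/
theorem formulaLetters_bot {k : ℕ} : formulaLetters (⊥ : L.BoundedFormula Empty k) = [4 * k + 11] :=
  formulaLetters_falsum

/-- Letters of a negation `∼φ = φ ⟹ ⊥`. [folklore] -/
theorem formulaLetters_not {k : ℕ} (φ : L.BoundedFormula Empty k) :
    formulaLetters φ.not = 3 :: (formulaLetters φ ++ [4 * k + 11]) := by
  rw [BoundedFormula.not, formulaLetters_imp, formulaLetters_bot]

/-- Letters of a conjunction `φ ⊓ ψ = ∼(φ ⟹ ∼ψ)`. [folklore] -/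
theorem formulaLetters_inf {k : ℕ} (φ ψ : L.BoundedFormula Empty k) :
    formulaLetters (φ ⊓ ψ) =
      3 :: ((3 :: (formulaLetters φ ++ 3 :: (formulaLetters ψ ++ [4 * k + 11]))) ++ [4 * k + 11]) := by
  show formulaLetters ((φ.imp ψ.not).not) = _
  rw [formulaLetters_not, formulaLetters_imp, formulaLetters_not]

/-- Letters of the universal closure `φ.alls`: `k` letters `7`, then the letters of `φ`. [folklore] -/
theorem formulaLetters_alls : ∀ {k : ℕ} (φ : L.BoundedFormula Empty k),
    formulaLetters φ.alls = List.replicate k 7 ++ formulaLetters φ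
  | 0, _ => rfl
  | k + 1, φ => by
    rw [BoundedFormula.alls, formulaLetters_alls φ.all, formulaLetters_all, List.replicate_succ',
      List.append_assoc, List.singleton_append]

/-- Letters of the atomic formula `&i₁ ≤ &i₂` at depth `k` (ordered language). [folklore] -/
theorem formulaLetters_le_var [L.IsOrdered] {k : ℕ} (i₁ i₂ : Fin k) :
    formulaLetters ((var (Sum.inr i₁)).le (var (Sum.inr i₂)) : L.BoundedFormula Empty k) =
      [4 * encode (⟨2, leSymb⟩ : Σ n, L.Relations n) + 1, 4 * k + 3,
        2 * Nat.pair k (encode [4 * i₁.val + 2]), 2 * Nat.pair k (encode [4 * i₂.val + 2])] := by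
  rw [Term.le, Relations.boundedFormula₂, Relations.boundedFormula, formulaLetters_rel]
  simp [encode_term_eq]

end DerivedLetters

/-! ### Letter builders for `∃'` and for order atoms -/

/-- Letters of `&i₁ ≤ &i₂` at depth `k`, given the code `rLe` of the symbol `≤`. [folklore] -/
def leLetters (rLe k i₁ i₂ : ℕ) : List ℕ :=
  [4 * rLe + 1, 4 * k + 3, 2 * Nat.pair k (encode [4 * i₁ + 2]), 2 * Nat.pair k (encode [4 * i₂ + 2])]

/-- Letters of `∃' θ` at depth `k` from the letters `w` of `θ` (depth `k + 1`). [folklore] -/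
def exLetters (k : ℕ) (w : List ℕ) : List ℕ :=
  3 :: 7 :: 3 :: (w ++ [4 * (k + 1) + 11, 4 * k + 11])

/-! ### Primitive recursiveness of the letter transformations -/

section PrimrecLetters

open Primrec

/-- `liftLettersAux` as a left fold with state (previous letter, reversed output). [folklore] -/
theorem liftLettersAux_eq_foldl (j m : ℕ) : ∀ (p : ℕ) (acc : List ℕ) (l : List ℕ),
    acc.reverse ++ liftLettersAux j m p l =
      ((l.foldl (fun (s : ℕ × List ℕ) (x : ℕ) => (x, liftLetter j m s.1 x :: s.2)) (p, acc)).2).reverse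
  | p, acc, [] => by simp
  | p, acc, x :: l => by
    rw [liftLettersAux_cons, List.foldl_cons, ← liftLettersAux_eq_foldl j m x (liftLetter j m p x :: acc) l,
      List.reverse_cons, List.append_assoc, List.singleton_append]

/-- `bumpVar` is primitive recursive in `(j, m, x)`. [folklore] -/
theorem primrec_bumpVar : Primrec fun q : ℕ × ℕ × ℕ => bumpVar q.1 q.2.1 q.2.2 := by
  have hx : Primrec fun q : ℕ × ℕ × ℕ => q.2.2 := snd.comp snd
  unfold bumpVar
  refine ite (PrimrecPred.and (PrimrecRel.comp Primrec.eq (nat_mod.comp hx (const 4)) (const 2))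
    (PrimrecRel.comp nat_le (fst.comp snd) (nat_div.comp hx (const 4)))) ?_ hx
  exact nat_add.comp hx (nat_mul.comp (const 4) fst)

/-- `liftTermCode` is primitive recursive in `(j, m, c)`. [folklore] -/
theorem primrec_liftTermCode : Primrec fun q : ℕ × ℕ × ℕ => liftTermCode q.1 q.2.1 q.2.2 := by
  unfold liftTermCode
  refine Primrec.encode.comp (list_map ((Primrec.ofNat (List ℕ)).comp (snd.comp snd)) ?_)
  exact (primrec_bumpVar.comp (Primrec.pair (fst.comp fst) (Primrec.pair (fst.comp (snd.comp fst)) snd))).to₂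

/-- `liftLetter` is primitive recursive in `((j, m), (prev, x))`. [folklore] -/
theorem primrec_liftLetter :
    Primrec fun q : (ℕ × ℕ) × (ℕ × ℕ) => liftLetter q.1.1 q.1.2 q.2.1 q.2.2 := by
  have hx : Primrec fun q : (ℕ × ℕ) × (ℕ × ℕ) => q.2.2 := snd.comp snd
  have hp : Primrec fun q : (ℕ × ℕ) × (ℕ × ℕ) => q.2.1 := fst.comp snd
  have hj : Primrec fun q : (ℕ × ℕ) × (ℕ × ℕ) => q.1.1 := fst.comp fst
  have hm : Primrec fun q : (ℕ × ℕ) × (ℕ × ℕ) => q.1.2 := snd.comp fst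
  have hu : Primrec fun q : (ℕ × ℕ) × (ℕ × ℕ) => (q.2.2 / 2).unpair := unpair.comp (nat_div.comp hx (const 2))
  unfold liftLetter
  refine ite (PrimrecRel.comp Primrec.eq (nat_mod.comp hx (const 2)) (const 0)) ?_ ?_
  · exact nat_mul.comp (const 2) (Primrec₂.natPair.comp (nat_add.comp (fst.comp hu) hj)
      (primrec_liftTermCode.comp (Primrec.pair hj (Primrec.pair hm (snd.comp hu)))))
  refine ite (PrimrecRel.comp Primrec.eq (nat_mod.comp hx (const 4)) (const 1)) hx ?_
  refine ite (PrimrecRel.comp Primrec.eq (nat_mod.comp hp (const 4)) (const 1))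
    (nat_add.comp hx (nat_mul.comp (const 4) hj)) ?_
  exact ite (PrimrecRel.comp nat_le (const 11) hx) (nat_add.comp hx (nat_mul.comp (const 4) hj)) hx

/-- `liftLetters` is primitive recursive in `((j, m), l)`. [folklore] -/
theorem primrec_liftLetters : Primrec fun q : (ℕ × ℕ) × List ℕ => liftLetters q.1.1 q.1.2 q.2 := by
  have h := list_foldl (α := (ℕ × ℕ) × List ℕ) (σ := ℕ × List ℕ) snd (const ((0 : ℕ), ([] : List ℕ)))
    ((Primrec.pair (snd.comp snd) (list_cons.comp
      (primrec_liftLetter.comp (Primrec.pair (fst.comp fst)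
        (Primrec.pair (fst.comp (fst.comp snd)) (snd.comp snd))))
      (snd.comp (fst.comp snd)))).to₂)
  refine ((list_reverse.comp (snd.comp h)).of_eq fun q => ?_)
  have := liftLettersAux_eq_foldl q.1.1 q.1.2 0 [] q.2
  rw [List.reverse_nil, List.nil_append] at this
  rw [liftLetters, this]

/-- `leLetters` is primitive recursive in `(rLe, k, i₁, i₂)`. [folklore] -/
theorem primrec_leLetters : Primrec fun q : ℕ × ℕ × ℕ × ℕ => leLetters q.1 q.2.1 q.2.2.1 q.2.2.2 := by
  have hr : Primrec fun q : ℕ × ℕ × ℕ × ℕ => q.1 := fst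
  have hk : Primrec fun q : ℕ × ℕ × ℕ × ℕ => q.2.1 := fst.comp snd
  have h1 : Primrec fun q : ℕ × ℕ × ℕ × ℕ => q.2.2.1 := fst.comp (snd.comp snd)
  have h2 : Primrec fun q : ℕ × ℕ × ℕ × ℕ => q.2.2.2 := snd.comp (snd.comp snd)
  have henc : Primrec fun i : ℕ => encode [4 * i + 2] :=
    Primrec.encode.comp (list_cons.comp (nat_add.comp (nat_mul.comp (const 4) Primrec.id) (const 2))
      (const []))
  unfold leLetters
  refine list_cons.comp (nat_add.comp (nat_mul.comp (const 4) hr) (const 1)) ?_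
  refine list_cons.comp (nat_add.comp (nat_mul.comp (const 4) hk) (const 3)) ?_
  refine list_cons.comp (nat_mul.comp (const 2) (Primrec₂.natPair.comp hk (henc.comp h1))) ?_
  exact list_cons.comp (nat_mul.comp (const 2) (Primrec₂.natPair.comp hk (henc.comp h2))) (const [])

/-- `exLetters` is primitive recursive in `(k, w)`. [folklore] -/
theorem primrec_exLetters : Primrec fun q : ℕ × List ℕ => exLetters q.1 q.2 := by
  unfold exLetters
  have hk : Primrec fun q : ℕ × List ℕ => q.1 := fst
  have hf : Primrec fun q : ℕ × List ℕ => [4 * (q.1 + 1) + 11, 4 * q.1 + 11] :=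
    list_cons.comp (nat_add.comp (nat_mul.comp (const 4) (nat_add.comp hk (const 1))) (const 11))
      (list_cons.comp (nat_add.comp (nat_mul.comp (const 4) hk) (const 11)) (const []))
  exact list_cons.comp (const 3) (list_cons.comp (const 7) (list_cons.comp (const 3)
    (list_append.comp snd hf)))

end PrimrecLetters

end Literature.ModelTheory.ProofTheory.PreFOL
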